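import Literature.Probability.RandomPlanarGeometry.ConformalWelding
import Literature.Topology.PlaneTopology.ArcLoops

/-!
# Welding continuity, part D: parametrising convergent simple chords

Support file for item `stmt-CriticalPhenomena-4509` (`SAWWeldingIdentification.WeldingContinuity`).

* `exists_isSimple_params` — if simple curve classes `γ_n → γ` (simple) in `CurveClass ℂ` (the
  reparametrisation distance of Aizenman–Burchard), there are INJECTIVE parametrisations `q_n` of
  `γ_n` and `p` of `γ` with `q_n → p` uniformly on `[0, 1]` (reparametrise a representative of
  `γ_n` by the inverse of an almost optimal matching `φ_n`).
* the real-line parametrisation `P = IccExtend p : ℝ → ℂ` of a simple chord of the Dobrushin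
  domain `Q.chord 0 2`: continuous, injective on `[0, 1]`, endpoints `a, b`, trace `γ.range`,
  interior points in `Ω` (`chordParam_*`), i.e. the data consumed by part B;
* uniform convergence is inherited by the extensions and by the concatenated bank loops
  (`tendstoUniformly_IccExtend`, `tendstoUniformly_concatPath_fract`).

References: M. Aizenman, A. Burchard, Duke Math. J. 99 (1999), §2.1; Pommerenke (1992), §2.2.
-/

noncomputable section

open Set Filter Metric
open scoped Topology
open Literature.Probability.RandomPlanarGeometry Literature.Topology.PlaneTopology

namespace Summit.CriticalPhenomena.SAWScalingLimit.Theorems.WeldingContinuity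

/-! ### Injective parametrisations of convergent simple classes -/

/-- **Convergent simple curve classes have uniformly convergent injective parametrisations.** If
`γ_n → γ` in `CurveClass ℂ` with all `γ_n` and `γ` simple, there are injective curves `q_n`, `p`
representing `γ_n`, `γ` whose parametrisations converge uniformly: the sup distance of `q_n` and
`p` tends to `0`. [cite: AizenmanBurchard1999, §2.1] -/
theorem exists_isSimple_params {γs : ℕ → CurveClass ℂ} {γ : CurveClass ℂ}
    (hs : ∀ n, γs n ∈ CurveClass.simple) (h : γ ∈ CurveClass.simple)
    (hconv : Tendsto γs atTop (𝓝 γ)) :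
    ∃ (p : Curve ℂ) (q : ℕ → Curve ℂ), p.IsSimple ∧ (∀ n, (q n).IsSimple) ∧
      CurveClass.mk p = γ ∧ (∀ n, CurveClass.mk (q n) = γs n) ∧
      Tendsto (fun n => dist (q n).toContinuousMap p.toContinuousMap) atTop (𝓝 0) := by
  obtain ⟨p, hp, rfl⟩ := h
  choose p' hp' hp'eq using hs
  have hd : Tendsto (fun n => dist (γs n) (CurveClass.mk p)) atTop (𝓝 0) :=
    (tendsto_iff_dist_tendsto_zero).1 hconv
  have hex : ∀ n, ∃ φ : unitInterval ≃o unitInterval,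
      dist (p' n).toContinuousMap ((p.reparam φ).toContinuousMap) <
        dist (γs n) (CurveClass.mk p) + 1 / ((n : ℝ) + 1) := fun n => by
    refine Curve.exists_dist_reparam_lt ?_
    rw [← hp'eq n, CurveClass.dist_mk_mk]
    have : (0 : ℝ) < 1 / ((n : ℝ) + 1) := Nat.one_div_pos_of_nat
    linarith
  choose φ hφ using hex
  refine ⟨p, fun n => (p' n).reparam (φ n).symm, hp, fun n => ?_, rfl, fun n => ?_, ?_⟩
  · intro s t hst
    simp only [Curve.reparam_apply] at hst
    exact (φ n).symm.injective (hp' n hst)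
  · rw [CurveClass.mk_reparam, hp'eq n]
  · have hlim := hd.add tendsto_one_div_add_atTop_nhds_zero_nat
    rw [add_zero] at hlim
    refine squeeze_zero (fun n => dist_nonneg) (fun n => ?_) hlim
    rw [dist_comm, ← Curve.dist_reparam_symm]
    exact (hφ n).le

/-! ### The real-line parametrisation of a simple chord -/

section ChordParam

variable {Q : ConformalRectangle} {p : Curve ℂ}

/-- The extension `IccExtend p` of a curve is continuous on `ℝ`. [folklore] -/
theorem continuous_chordParam (p : Curve ℂ) :
    Continuous (IccExtend zero_le_one (p : unitInterval → ℂ)) :=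
  p.continuous.Icc_extend'

/-- The extension of an injective curve is injective on `[0, 1]`. [folklore] -/
theorem injOn_chordParam (hp : p.IsSimple) :
    InjOn (IccExtend zero_le_one (p : unitInterval → ℂ)) (Icc 0 1) := by
  intro s hs t ht h
  rw [IccExtend_of_mem _ _ hs, IccExtend_of_mem _ _ ht] at h
  exact congrArg Subtype.val (hp h)

/-- The extension starts at the source of the curve. [folklore] -/
theorem chordParam_zero (p : Curve ℂ) :
    IccExtend zero_le_one (p : unitInterval → ℂ) 0 = (CurveClass.mk p).source := by
  rw [IccExtend_left]
  rfl

/-- The extension ends at the target of the curve. [folklore] -/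
theorem chordParam_one (p : Curve ℂ) :
    IccExtend zero_le_one (p : unitInterval → ℂ) 1 = (CurveClass.mk p).target := by
  rw [IccExtend_right]
  rfl

/-- On `[0, 1]` the extension traces the trace of the curve class. [folklore] -/
theorem image_chordParam (p : Curve ℂ) :
    IccExtend zero_le_one (p : unitInterval → ℂ) '' Icc 0 1 = (CurveClass.mk p).range := by
  rw [CurveClass.range_mk]
  ext z
  constructor
  · rintro ⟨t, ht, rfl⟩
    rw [IccExtend_of_mem _ _ ht]
    exact ⟨_, rfl⟩
  · rintro ⟨t, rfl⟩
    exact ⟨t.val, t.property, by rw [IccExtend_val]⟩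

/-- For a simple chord of `(Ω; a, b) = Q.chord 0 2` parametrised injectively, the interior
parameters are mapped into `Ω`. [folklore] -/
theorem chordParam_mem_carrier (hp : p.IsSimple)
    (hγ : (Q.chord 0 2 (by decide)).IsSimpleChord (CurveClass.mk p)) {t : ℝ} (ht : t ∈ Ioo (0 : ℝ) 1) :
    IccExtend zero_le_one (p : unitInterval → ℂ) t ∈ Q.carrier := by
  have ht' : t ∈ Icc (0 : ℝ) 1 := ⟨ht.1.le, ht.2.le⟩
  rw [IccExtend_of_mem _ _ ht']
  have hmem : p ⟨t, ht'⟩ ∈ (CurveClass.mk p).range := ⟨_, rfl⟩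
  have hcl : p ⟨t, ht'⟩ ∈ closure Q.carrier := hγ.range_subset_closure hmem
  rw [closure_eq_self_union_frontier] at hcl
  rcases hcl with h | hfr
  · exact h
  · exfalso
    have h2 := hγ.range_inter_frontier_subset ⟨hmem, hfr⟩
    simp only [MarkedDomain.pt_chord_zero, MarkedDomain.pt_chord_one, mem_insert_iff,
      mem_singleton_iff] at h2
    have hs0 : p 0 = Q.pt 0 := hγ.source_eq
    have ht1 : p 1 = Q.pt 2 := hγ.target_eq
    rw [← hs0, ← ht1] at h2
    rcases h2 with h2 | h2
    · have := congrArg Subtype.val (hp h2)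
      simp only at this
      exact ht.1.ne' this
    · have := congrArg Subtype.val (hp h2)
      simp only at this
      exact ht.2.ne this

/-- Endpoint of a simple chord parametrisation: `P 0 = Q.pt 0`. [folklore] -/
theorem chordParam_zero_eq_pt (hγ : (Q.chord 0 2 (by decide)).IsSimpleChord (CurveClass.mk p)) :
    IccExtend zero_le_one (p : unitInterval → ℂ) 0 = Q.pt 0 := by
  rw [chordParam_zero, hγ.source_eq]; rfl

/-- Endpoint of a simple chord parametrisation: `P 1 = Q.pt 2`. [folklore] -/
theorem chordParam_one_eq_pt (hγ : (Q.chord 0 2 (by decide)).IsSimpleChord (CurveClass.mk p)) :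
    IccExtend zero_le_one (p : unitInterval → ℂ) 1 = Q.pt 2 := by
  rw [chordParam_one, hγ.target_eq]; rfl

end ChordParam

/-! ### Uniform convergence of the extensions and of the bank loops -/

/-- Uniform convergence of parametrisations on `[0, 1]` gives uniform convergence of their
extensions on `ℝ`. [folklore] -/
theorem tendstoUniformly_IccExtend {q : ℕ → Curve ℂ} {p : Curve ℂ}
    (h : Tendsto (fun n => dist (q n).toContinuousMap p.toContinuousMap) atTop (𝓝 0)) :
    TendstoUniformly (fun n => IccExtend zero_le_one (q n : unitInterval → ℂ))
      (IccExtend zero_le_one (p : unitInterval → ℂ)) atTop := by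
  rw [Metric.tendstoUniformly_iff]
  intro ε hε
  have hev : ∀ᶠ n in atTop, dist (q n).toContinuousMap p.toContinuousMap < ε := by
    have := (tendsto_order.1 h).2 ε hε
    exact this
  filter_upwards [hev] with n hn x
  simp only [IccExtend, Function.comp_apply]
  rw [dist_comm]
  exact (ContinuousMap.dist_apply_le_dist (f := (q n).toContinuousMap) (g := p.toContinuousMap)
    _).trans_lt hn

/-- Uniformly convergent chords give uniformly convergent bank loops (the boundary arc is
common). [folklore] -/
theorem tendstoUniformly_concatPath_fract {P : ℕ → ℝ → ℂ} {Pl : ℝ → ℂ} (A : ℝ → ℂ)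
    (h : TendstoUniformly P Pl atTop) :
    TendstoUniformly (fun n => concatPath (P n) A ∘ Int.fract) (concatPath Pl A ∘ Int.fract)
      atTop := by
  rw [Metric.tendstoUniformly_iff] at h ⊢
  intro ε hε
  filter_upwards [h ε hε] with n hn x
  simp only [Function.comp_apply]
  by_cases hx : Int.fract x ≤ 1 / 2
  · rw [concatPath_of_le_half hx, concatPath_of_le_half hx]
    exact hn _
  · rw [concatPath_of_half_lt (not_le.1 hx), concatPath_of_half_lt (not_le.1 hx), dist_self]
    exact hε

end Summit.CriticalPhenomena.SAWScalingLimit.Theorems.WeldingContinuity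

end
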